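import Summits.SmoothPoincare4.SmoothPoincare4.Theses.VerlindeRLinks
import Literature.Barriers.SmoothPoincare4.PropertyTwoRAndrewsCurtisLink
import HarnessLib.Audit

/-!
# Birth skeleton (BC3) for crux `VerlindeRLinks.VrlSlideGap` (item stmt-SmoothPoincare4-16178)

`Cruxes/VrlSlideGap/Lines/birth.lean` · registrar planner-skel-stmt-SmoothPoincare4-16178-0 ·
2026-08-17 · mode skeleton-register (route re-audit bin REPAIRABLE; route
`route-SmoothPoincare4-VerlindeRLinks`, NEGATIVE-SIDE route, crux rank 2, `checked_at`
2026-08-16, grounded NEW / OPEN-PROBLEM). The crux is FIXED and is concluded BY NAME: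

  `Summit.SmoothPoincare4.SmoothPoincare4.Theses.VerlindeRLinks.VrlSlideGap`

SLIDE GAP: there are `n`, an `n`-component framed link `L ⊂ S³` and a closed smooth 3-manifold
`Y ≅ #ⁿ(S² × S¹)` with `Y` = integral surgery on `L` (an R-link) such that `L` is NOT strictly
handle-slide equivalent (`IsStrictHandleSlideEquivalent`: isotopy, renumbering, reversal, strict
2-handle slides) to any `0`-framed unlink — i.e. the PRINTED Generalised Property R conjecture
`Literature.Topology.FourManifolds.StrictGeneralizedPropertyRConjecture` fails (refuter precision note
2026-08-16: `VrlSlideGap ↔ ¬ StrictGeneralizedPropertyRConjecture`, the leading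
`∃ (_ : Knot.TubularNbhd.SmoothnessFacts)` being the tree-PROVED Prop-class
`Knot.TubularNbhd.isSmoothEmbedding_pushOff_holds`, carried as a binder so that the route file does
not import `LinkingNumberPushOffInstance`; this file keeps the same convention — no instance import,
the class travels as an `∃`-binder through the stubs).

## The cut — GOMPF–SCHARLEMANN–THOMPSON'S REDUCTION TO ANDREWS–CURTIS, typed over the tree

The one line for `¬`(printed GPRC) that the tree can TYPE today is Gompf–Scharlemann–Thompson 2010,
§7 (arXiv:1103.1601; = GST): the 2-component R-links `L_{n,1} = Q ⊔ Vₙ` (square knot interleaved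
with `T_{n,n+1} # T̄_{n,n+1}`, Figure 11; surgery `#²(S¹ × S²)` by Gompf's Kirby calculus [Go1])
determine, through the meridian presentation of `π₁` of the surgered manifold, the balanced
presentations `⟨x, y ∣ yxy = xyx, xⁿ⁺¹ = yⁿ⟩` (`gstPresentation n`, = Akbulut–Kirby `AK(n)` up to
`x ↔ y`) of the trivial group, and a STRICT 2-handle slide acts on meridian presentations by an
Andrews–Curtis move (the dual slide), the `0`-framed unlink giving the trivial presentation. Hence:

* `stub_gstLink` (KNOWN IN PRINT, XL formally — GST §7 with [Go1]; the tree's named fact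
  `Literature.Barriers.SmoothPoincare4.gst2010_link_acTrivial_of_slides`, verbatim, under the
  `∃`-bound smoothness class): for every `n` there is a 2-component framed link `L` in `S³` whose
  surgery is some closed connected smooth `Y` with `IsSphereTwoProdCircleSum 2 Y`, such that for
  every `0`-framed unlink `U`, `IsStrictHandleSlideEquivalent ⟨2, L⟩ ⟨2, U⟩ →
  IsAndrewsCurtisEquivalent (gstPresentation n) (trivial 2)`. Why it might fail: only as TYPED
  (an explicit smooth `L_{n,1}` as a `FramedLink (Fin 2)` with its `0`-surgery identified with
  `#²(S² × S¹)`, and the Andrews–Curtis invariance of meridian presentations under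
  `FramedLink.IsStrictHandleSlide`, are each theory-sized; the librarian's fact-decomposition record
  `PropertyTwoRAndrewsCurtisLink.lean` names the bricks being laid:
  `DehnSurgeryLinkFundamentalGroup`, `LinkGroupMeridians`, `SphereTwoProdCircleSumFundamentalGroup`,
  `KirbyMovesSlideModel`). Size: XL.
* `stub_acNontrivial` (OPEN — the HEART; the tree's registered open conjecture
  `Literature.Barriers.SmoothPoincare4.AKPresentationsACNontrivial`, verbatim): some
  `⟨x, y ∣ yxy = xyx, xⁿ⁺¹ = yⁿ⟩` with `n ≥ 3` is NOT Andrews–Curtis equivalent to the trivial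
  presentation — "deemed likely by group theorists when `n ≥ 3`" (GST §1), "there is presently no
  way to distinguish Andrews-Curtis equivalence classes from each other" (GST §7). Equivalently
  (tree, proved): some Akbulut–Kirby presentation `akbulutKirby k` is Andrews–Curtis nontrivial
  (`akPresentationsACNontrivial_iff_exists_akbulutKirby`); the guard `3 ≤ n` is automatic
  (`akPresentationsACNontrivial_iff_exists`, GST §8 / Gersten for `n ≤ 2`). Why it might fail: the
  (unstable) Andrews–Curtis conjecture may simply be TRUE on the family — `AK(2)` fell to Gersten /
  Miasnikov, and large computer searches keep shortening the known trivialisation frontier without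
  ever producing an invariant; every known AC-invariant that is computable factors through data
  that is constant on presentations of the trivial group. Size: open-problem (Andrews–Curtis 1965,
  Akbulut–Kirby 1985).

`VrlSlideGap_of : Sig.stub_gstLink → Sig.stub_acNontrivial → VrlSlideGap` is PROVED below (§3, no
`sorry`): the tree's assembly `Literature.Barriers.SmoothPoincare4.StrictPropertyTwoRBarrier_holds_of`
turns GST's link into the barrier `AKPresentationsACNontrivial → ¬ StrictPropertyTwoRConjecture`;
Andrews–Curtis nontriviality then refutes the printed Property 2R, and classical logic over the
binders (a 2-component link that slides to no `0`-framed unlink is a slide gap with `n = 2`;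
also recorded separately as a checked glue `example`, §3) concludes the crux BY NAME. The
statements live in `Sig.stub_*` so that the hypothesis heads of `VrlSlideGap_of` carry the
registered stub names; the closed composition is an `example` only.

Hardest stub: `stub_acNontrivial` (a proof DISPROVES the Andrews–Curtis conjecture on its standard
test family; open since 1965/1985). `stub_gstLink` is true in print and XL to formalize.

## Relation to the route's intended engine (the Décoppet–Haïoun skein certificate)

The route header's TWO-LAYER PLAN is `VrlSlideGap ⇐ VrlSkeinCertificate (σ_p(L₀) ≠ σ_p(∅) for an
explicit R-link L₀) → VrlSkeinFunctorial (σ_p invariant under strict slides, unlink-normalised)`,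
with `σ_p` the closed-off value of the height-2 mixed Verlinde / Temperley–Lieb skein functor in
characteristic `p` (arXiv:2512.14849, arXiv:2306.03225). That plan is NOT TYPABLE today: `σ_p` is
definition request D1 of the route (`mixedVerlindeRLinkInvariant`, not in the tree), and an
`∃ σ, slide-invariant ∧ separating` surrogate would merely restate the crux (costume). This birth
line is therefore the classical GST reduction, the one decomposition of `¬`GPRC over existing
declarations; the skein engine re-enters in two typed places: (i) as a prover of `stub_acNontrivial`
IF `σ_p` of an R-link turns out to factor through the Andrews–Curtis class of its meridian
presentation (then `σ_p(L_{n,1}) ≠ 1` is an AC-invariant separating `AK(n)` from the trivial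
presentation — exactly the missing "way to distinguish Andrews–Curtis classes"); (ii) directly
through the two glue `example`s of §3 (`(∃ _, ¬ StrictPropertyTwoRConjecture) → VrlSlideGap` and
`(∃ _, ¬ StrictGeneralizedPropertyRConjecture) → VrlSlideGap`: any certified 2-component, resp.
`n`-component, R-link that slides to no unlink closes the crux without any Andrews–Curtis
statement) — the entry point of a second line `Lines/skein.lean` once D1 lands.

## BC3 probes, Disproof, Barriers

BC3 probes (registrar, 2026-08-17; files `bc/probe_<stub>_<target>.lean` in the registrar's folder
= §1 of this file verbatim plus the probes; raw `lean check --json` outputs alongside; table in its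
NOTES.md and in the crux evidence note): 2 stubs × {`→ VrlSlideGap`, `→ SmoothPoincare4`,
`→ ¬ SmoothPoincare4` (the route is refutation-form)} × {`first | exact? | simpa | aesop`,
`exact?`, `simpa [Sig.stub_x, VrlSlideGap]`, `(unfold Sig.stub_x VrlSlideGap; simpa)`, `aesop`}:
ALL FAIL (see NOTES.md for rc and the unsolved goals). No stub is cheaply the crux or the summit:
`stub_gstLink` is a theorem in print about ONE link family and implies nothing about sliding
without an Andrews–Curtis input; `stub_acNontrivial` is pure combinatorial group theory and
reaches framed links only through `stub_gstLink`.

Disproof used: none exists for this crux (`ledger crux ls stmt-SmoothPoincare4-16178`: no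
workfiles before this one, no `Disproof.lean`, no `_false_without_` obstruction, no
`Theorems/VrlSlideGap/Negative/*`, 2026-08-17); `ledger negatives --problem SmoothPoincare4`: 0
refuted statements. Refuter evidence on the item (NOTE_VrlSlideGap.md, 2026-08-16: item ≡
`¬ StrictGeneralizedPropertyRConjecture`; survives all cheap attacks; "conditional paper proof
from AKPresentationsACNontrivial + GST §7; unconditional proof needs an AC-class-separating
invariant") is honoured verbatim: that conditional paper proof IS this skeleton, with the
condition and the §7 implication as its two named stubs and the glue proved.

Barriers (route technique_class: nonsemisimple-skein, r-link-slides, fgmw-hslice):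
`Literature.Barriers.SmoothPoincare4.StrictPropertyTwoRBarrier` — ENGAGED HEAD-ON and USED, not
evaded: the barrier's named statement is literally the implication this line composes
(`StrictPropertyTwoRBarrier_holds_of stub_gstLink : AKPresentationsACNontrivial → ¬ Property 2R`);
on the negative side of SPC4 a barrier against PROVING GPRC is a resource. `StableBarrierFour`,
`GluckTwistCP2Barrier`, `GaugeSumBarrierFour`, `HCobordismInvariantBarrierFour`,
`TopologicalBarrierFour` — not engaged (no 4-manifold invariant is evaluated on this line; it is
handle calculus of links plus combinatorial group theory).
-/

noncomputable section

-- every `Summit.SmoothPoincare4.SmoothPoincare4.…` name repeats the summit = sub-problem segment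
-- (D-0017 layout); the duplicate is deliberate.
set_option linter.dupNamespace false
set_option linter.unusedVariables false

namespace Summit.SmoothPoincare4.SmoothPoincare4.Cruxes.VrlSlideGap.Birth

open scoped Manifold ContDiff
open Literature.Topology.FourManifolds
open Literature.Barriers.SmoothPoincare4 (gstPresentation AKPresentationsACNontrivial
  gst2010_link_acTrivial_of_slides StrictPropertyTwoRBarrier_holds_of)
open Summit.SmoothPoincare4.SmoothPoincare4.Theses.VerlindeRLinks (VrlSlideGap)

/-! ## §1 The stub SIGNATURES (`Sig.stub_<name>`; the skeleton audit reads the hypotheses of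
`VrlSlideGap_of` BY NAME, heads = stub names) -/

/-- **STUB 1 — GST's LINK** (KNOWN IN PRINT, XL formally; Gompf–Scharlemann–Thompson 2010 §7 with
§1, §2 and Gompf 1991 [Go1]). Under the (tree-proved) smoothness class carried as an `∃`-binder
exactly as in the crux: for every `n : ℕ` there is a 2-component framed link `L` in `S³` — GST's
`L_{n,1}` — such that (i) some closed connected smooth 3-manifold `Y` with
`IsSphereTwoProdCircleSum 2 Y` is the surgery on `L`, and (ii) for every `0`-framed unlink `U`, if
`⟨2, L⟩` and `⟨2, U⟩` are strictly handle-slide equivalent then `gstPresentation n =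
⟨x, y ∣ yxy = xyx, xⁿ⁺¹ = yⁿ⟩` is Andrews–Curtis equivalent to the trivial presentation ("If the
2-component link `L_{n,k}` … can be changed to the unlink by handle slides, then the dual slides in
Figure 9 will trivialize that picture", GST §7, arXiv p. 17). The body is the tree's named fact
`Literature.Barriers.SmoothPoincare4.gst2010_link_acTrivial_of_slides` BY NAME (its discharge
`_holds`, when it lands, closes this stub in one line after `import
Literature.Topology.FourManifolds.LinkingNumberPushOffInstance`: `⟨inferInstance, …_holds⟩`).
Why it might fail: only as typed (explicit smooth `L_{n,1}`, its surgery, `π₁` of surgered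
manifolds under strict slides — each theory-sized). Size: XL.
[GompfScharlemannThompson2010 §7, §1 p. 2, §2, §8; Gompf1991Killing; arXiv:1103.1601] -/
def Sig.stub_gstLink : Prop :=
  ∃ (_ : Knot.TubularNbhd.SmoothnessFacts), gst2010_link_acTrivial_of_slides

/-- **STUB 2 — ANDREWS–CURTIS NONTRIVIALITY OF SOME `AK(n)`, `n ≥ 3`** (OPEN — the HEART). Some
presentation `⟨x, y ∣ yxy = xyx, xⁿ⁺¹ = yⁿ⟩` with `3 ≤ n` is not Andrews–Curtis equivalent (moves
`rᵢ ↦ rᵢ⁻¹`, `rᵢ ↦ rᵢ rⱼ`, `rᵢ ↦ g rᵢ g⁻¹`) to the trivial presentation of rank 2. The body is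
the tree's registered open conjecture `Literature.Barriers.SmoothPoincare4.AKPresentationsACNontrivial`
BY NAME; robust under the choice of Andrews–Curtis calculus (`akPresentationsACNontrivial_iff_ext`)
and equal to the nontriviality of some Akbulut–Kirby presentation
(`akPresentationsACNontrivial_iff_exists_akbulutKirby`). A proof is a disproof of the (unstable)
Andrews–Curtis conjecture on its standard test family; it needs an invariant separating
Andrews–Curtis classes of balanced presentations of the TRIVIAL group, none being known (GST §7) —
the route's skein value `σ_p`, if it factors through meridian presentations, is a candidate. Why it
might fail: the family may be Andrews–Curtis trivial after all (`n ≤ 2` is: GST §8, Gersten), and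
all computable AC-invariants to date are blind on presentations of the trivial group.
Size: open-problem. [AndrewsCurtis1965; AkbulutKirby1985; GompfScharlemannThompson2010 §1, §7, §8;
Gompf1991Killing] -/
def Sig.stub_acNontrivial : Prop :=
  AKPresentationsACNontrivial

/-! ## §2 The registered stubs (the ONLY `sorry`s of this file) -/

/-- Registered stub 1 (KNOWN in print, XL): GST's link `L_{n,1}` and the Andrews–Curtis reading of
its strict slides. See `Sig.stub_gstLink`. -/
theorem stub_gstLink : Sig.stub_gstLink := by
  sorry

/-- Registered stub 2 (OPEN; the heart): some `⟨x, y ∣ yxy = xyx, xⁿ⁺¹ = yⁿ⟩`, `n ≥ 3`, is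
Andrews–Curtis nontrivial. See `Sig.stub_acNontrivial`. -/
theorem stub_acNontrivial : Sig.stub_acNontrivial := by
  sorry

/-! ## §3 The composition — the crux BY NAME from the two stubs (real proof, no `sorry`) — and glue -/

/-- **Skeleton theorem.** GST's link and Andrews–Curtis nontriviality of some `AK(n)` imply the
crux `Theses.VerlindeRLinks.VrlSlideGap` BY NAME: the tree's assembly
`StrictPropertyTwoRBarrier_holds_of` turns stub 1 into `AKPresentationsACNontrivial →
¬ StrictPropertyTwoRConjecture`, stub 2 discharges its hypothesis, and classical logic over the
binders packages the failing 2-component link as the gap (`n = 2`), the smoothness class being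
threaded from stub 1 to the conclusion. (This theorem is deliberately the FIRST declaration of the
file concluding the crux: the skeleton audit takes the first one.) -/
theorem VrlSlideGap_of :
    Sig.stub_gstLink → Sig.stub_acNontrivial →
      Summit.SmoothPoincare4.SmoothPoincare4.Theses.VerlindeRLinks.VrlSlideGap := by
  rintro ⟨inst, hGST⟩ hAC
  have h2R : ¬ StrictPropertyTwoRConjecture := StrictPropertyTwoRBarrier_holds_of hGST hAC
  by_contra hgap
  refine h2R fun L Y i₁ i₂ i₃ i₄ i₅ i₆ i₇ hY hL => ?_
  by_contra hU
  push Not at hU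
  exact hgap ⟨inst, 2, L, Y, i₁, i₂, i₃, i₄, i₅, i₆, i₇, hY, hL, hU⟩

/-! ### Glue entry points for OTHER lines (checked `example`s, deliberately not constants: the
skeleton audit admits exactly one theorem concluding the crux, `VrlSlideGap_of`) -/

/-- **Glue (n = 2 entry point).** A failure of the PRINTED Property 2R — some 2-component framed
link with surgery `(S² × S¹) # (S² × S¹)` strictly slides to no `0`-framed unlink — is a slide gap:
the crux with `n = 2`. This is the entry point of any CERTIFICATE line (a strict-slide invariant
separating one 2-component R-link from the unlink), e.g. the route's intended `σ_p`; the proof of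
`VrlSlideGap_of` above inlines it. -/
example (h : ∃ (_ : Knot.TubularNbhd.SmoothnessFacts), ¬ StrictPropertyTwoRConjecture) :
    VrlSlideGap := by
  obtain ⟨inst, h2R⟩ := h
  by_contra hgap
  refine h2R fun L Y i₁ i₂ i₃ i₄ i₅ i₆ i₇ hY hL => ?_
  by_contra hU
  push Not at hU
  exact hgap ⟨inst, 2, L, Y, i₁, i₂, i₃, i₄, i₅, i₆, i₇, hY, hL, hU⟩

/-- **Glue (general `n`).** A failure of the printed Generalised Property R conjecture is a slide
gap (the refuters' reading `VrlSlideGap ↔ ¬ StrictGeneralizedPropertyRConjecture`, forward half,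
with the smoothness class threaded). Entry point of an `n`-component certificate line. -/
example (h : ∃ (_ : Knot.TubularNbhd.SmoothnessFacts), ¬ StrictGeneralizedPropertyRConjecture) :
    VrlSlideGap := by
  obtain ⟨inst, hR⟩ := h
  by_contra hgap
  refine hR fun n L Y i₁ i₂ i₃ i₄ i₅ i₆ i₇ hY hL => ?_
  by_contra hU
  push Not at hU
  exact hgap ⟨inst, n, L, Y, i₁, i₂, i₃, i₄, i₅, i₆, i₇, hY, hL, hU⟩

/-- WIRING CHECK: the two sorried stubs compose to a closed term of the crux's type (modulo their
`sorry`s). Deliberately an `example` (no constant enters the environment). -/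
example : Summit.SmoothPoincare4.SmoothPoincare4.Theses.VerlindeRLinks.VrlSlideGap :=
  VrlSlideGap_of stub_gstLink stub_acNontrivial

end Summit.SmoothPoincare4.SmoothPoincare4.Cruxes.VrlSlideGap.Birth

end
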